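import Summits.BirchSwinnertonDyer.BirchSwinnertonDyer.Theses.CyclotomicUntwist
import Literature.NumberTheory.EllipticCurves.LeadingTermBSZOrdinaryProofs
import Literature.NumberTheory.EllipticCurves.BSDSelmerSkinnerThmBProofs
import Literature.NumberTheory.EllipticCurves.ExceptionalPrimesDensityModels
import Literature.NumberTheory.EllipticCurves.LFunctionSmulProofs
import Literature.NumberTheory.EllipticCurves.BSDpVariableChangeProofs
import Literature.NumberTheory.EllipticCurves.BSDInvariantsProofs
import Literature.NumberTheory.EllipticCurves.RootNumberSmulProofs
import Literature.NumberTheory.EllipticCurves.ComplexMultiplicationHasCMProofs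
import Literature.NumberTheory.EllipticCurves.GlobalMinimalModelProofs
import HarnessLib

/-!
# The K1 / K2 / X3 INSTANCES of route `CyclotomicUntwist` are MODEL-INVARIANT: every binder of the
# principal-series row and both conclusions agree on any two globally minimal models of one curve
# (MODEL COVARIANCE, part 5 — the crux texts themselves)

Cell `pub/bsd-wall` (D-0145 line `route-BirchSwinnertonDyer-CyclotomicUntwist`), width seat
`bsd-line-cycu-p5` (gen 8). THEOREMS ONLY (no definition, no named fact, no `sorry`); helper
`--supports` K1 = stmt-BirchSwinnertonDyer-21580 (serves K2 = 21581 and X3 = 21582 equally). BSD is not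
proved by this file and no crux of the route is.

WHY. K1 `PSRankOneLowerHalfAtThree`, K2 `PSRankOneUpperHalfAtThree` and X3
`WildSurjRankOneSupercuspidalAtThree` quantify over EVERY globally minimal `W/ℚ`; a curve has several
(related by `C = (±1, r, s, t)`, `r, s, t ∈ ℤ`, tree `isGloballyMinimal_unique_holds`). Parts 1–4 of this
lane showed that the D5 / σ-line data the K-SEP texts consume are model-COVARIANT («c shifts by r») with
model-INVARIANT consumed value. This file closes the loop on the crux TEXTS: every binder of the row and
both conclusions are invariants of the curve, by tree theorems collected here by name —

* §1 row binders: `addv_smul_iff` (`hasGoodReductionAtPrime_smul_iff`, `hasMultiplicativeReductionAtPrime_smul_iff`),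
  `potMult_smul_iff` (`j` is invariant, Mathlib `variableChange_j`), `condExp_smul` (`conductorExponent_smul'`,
  Silverman C.16), `subW_smul_iff`, **`classO6_smul_iff`**, **`surj_smul_iff`**
  (`hasSurjectiveModNGaloisRep_smul_iff`), `hasCM_smul_iff` (`hasCM_iff_of_j_eq`),
  **`minimalDiscriminantInt_smul`** (`minimalDiscriminantInt_smul_eq_holds`: the principal-series predicate
  «`v₃(Δ_min)` even ∧ `Δ_min/3^v ≡ 1 (mod 3)`» is LITERALLY the same on both models); the analytic rank by the tree's `analyticRank_smul`;
* §2 conclusions: **`missingLowerBoundAt_smul_iff`**, **`missingUpperBoundAt_smul_iff`**, `missingPPartAt_smul_iff`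
  (`shaAn_variableChange_of_isGloballyMinimal` + `shaOrder_variableChange_holds`; `BSDp`:
  tree `bsdp_variableChange_iff_of_isGloballyMinimal`);
* §3 **`psLowerHalfInstance_smul_iff`, `psUpperHalfInstance_smul_iff`, `scResidualInstance_smul_iff`** — the
  K1 / K2 / X3 instance at `C • W` ⟺ the instance at `W`; hence **`psRankOneLowerHalfAtThree_of_representatives`**
  (and the K2 / X3 twins): it suffices to prove the crux on ANY family of globally minimal models meeting
  every isomorphism class of the row — e.g. on the GNine-recipe models of cycu-p1/p2, or on reduced minimal
  models — the choice of model is free. Nothing here proves any instance.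

References: Silverman AEC VII.1.3(b), VIII.8.3, App. C §16 [SilvermanAEC2009]; R. L. Miller, LMS J. Comput.
Math. 14 (2011) Def. 1.1 [Miller2011LMS].
-/

set_option autoImplicit false
-- single-conjunct summit: `Summit.BirchSwinnertonDyer.BirchSwinnertonDyer.…` repeats the name by design
set_option linter.dupNamespace false

noncomputable section

open scoped Classical

open WeierstrassCurve Literature.NumberTheory.EllipticCurves Literature.NumberTheory.EllipticCurves.Rank1Residual
  Literature.NumberTheory.EllipticCurves.Rank1Residual.Typed Summit.BirchSwinnertonDyer.Rank1Residual.Additive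
  Summit.BirchSwinnertonDyer.BirchSwinnertonDyer.Theses.CyclotomicUntwist

namespace Summit.BirchSwinnertonDyer.BirchSwinnertonDyer.Theorems.PSRowModelInvariance

/-! ### §1 The binders of the principal-series row are invariants of the curve -/

section Binders

variable (W : WeierstrassCurve ℚ) [W.IsElliptic] (C : VariableChange ℚ) (p : ℕ) [Fact p.Prime]

/-- `Addv` (additive reduction: neither good nor multiplicative) is model-independent.
[cite: SilvermanAEC2009, VII.5 Prop. 5.1 and VII.1 Prop. 1.3(b)] -/
theorem addv_smul_iff : Addv (C • W) p ↔ Addv W p := by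
  unfold Addv
  rw [BSZLemma17.hasGoodReductionAtPrime_smul_iff W C p, hasMultiplicativeReductionAtPrime_smul_iff W C p]

omit [Fact p.Prime] in
/-- `PotMult` (`v_p(j) < 0`) is model-independent: `j(C • W) = j(W)`. [cite: SilvermanAEC2009, III.1.4(b)] -/
theorem potMult_smul_iff : PotMult (C • W) p ↔ PotMult W p := by
  unfold PotMult
  rw [variableChange_j]

/-- The conductor exponent `f_p` is model-independent (Silverman C.16; tree `conductorExponent_smul'`).
[cite: SilvermanAEC2009, App. C §16 (PDF pp. 390–391)] -/
theorem condExp_smul : condExp (C • W) p = condExp W p := by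
  unfold condExp
  exact conductorExponent_smul' (placeOf p) W C

/-- `CondExpTwo` (`f_p = 2`) is model-independent. [cite: SilvermanAEC2009, App. C §16 (PDF pp. 390–391)] -/
theorem condExpTwo_smul_iff : CondExpTwo (C • W) p ↔ CondExpTwo W p := by
  unfold CondExpTwo
  rw [condExp_smul]

/-- `SubW` (wild: not potentially multiplicative, `f_p ≠ 2`) is model-independent.
[cite: SilvermanAEC2009, App. C §16 (PDF pp. 390–391)] -/
theorem subW_smul_iff : SubW (C • W) p ↔ SubW W p := by
  unfold SubW
  rw [potMult_smul_iff, condExpTwo_smul_iff]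

/-- **`ClassO6` (wild additive, `p` odd) is model-independent.** [cite: SilvermanAEC2009, App. C §16 (PDF pp. 390–391)] -/
theorem classO6_smul_iff : ClassO6 (C • W) p ↔ ClassO6 W p := by
  unfold ClassO6
  rw [addv_smul_iff, subW_smul_iff]

omit [W.IsElliptic] in
/-- **`Surj` (`ρ̄_{E,p}` onto) is model-independent** (tree `hasSurjectiveModNGaloisRep_smul_iff`). [folklore] -/
theorem surj_smul_iff : Surj (C • W) p ↔ Surj W p :=
  hasSurjectiveModNGaloisRep_smul_iff W C p

omit [Fact p.Prime] in
/-- `HasCM` is model-independent (`j` is). [cite: SilvermanAEC2009, III.1.4(b)] -/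
theorem hasCM_smul_iff : (C • W).HasCM ↔ W.HasCM :=
  hasCM_iff_of_j_eq (W.variableChange_j C)

omit [Fact p.Prime] in
/-- **The minimal discriminant is literally the same integer on two globally minimal models** (tree
`minimalDiscriminantInt_smul_eq_holds`), so the principal-series predicate «`v₃(Δ_min)` even ∧
`Δ_min/3^{v} ≡ 1 (mod 3)`» of K1/K2 (and its negation in X3) is model-independent on the nose.
[cite: SilvermanAEC2009, VIII.8 (remark after Cor. 8.3)] -/
theorem minimalDiscriminantInt_smul [W.IsGloballyMinimal] [(C • W).IsGloballyMinimal] :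
    (C • W).minimalDiscriminantInt = W.minimalDiscriminantInt :=
  minimalDiscriminantInt_smul_eq_holds W C

end Binders

/-! ### §2 The conclusions `MissingLowerBoundAt` / `MissingUpperBoundAt` / `MissingPPartAt` -/

section Conclusions

variable (W : WeierstrassCurve ℚ) [W.IsElliptic] [W.IsGloballyMinimal] (C : VariableChange ℚ)
  [(C • W).IsGloballyMinimal] (p : ℕ)

/-- **`MissingLowerBoundAt` (`ord_p Ш_an ≤ ord_p #Ш`) is model-independent**: `Ш_an` and `#Ш` are
(`shaAn_variableChange_of_isGloballyMinimal`, `shaOrder_variableChange_holds`). [cite: Miller2011LMS, Def. 1.1 (arXiv:1010.2431 p. 3)] -/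
theorem missingLowerBoundAt_smul_iff : MissingLowerBoundAt (C • W) p ↔ MissingLowerBoundAt W p := by
  unfold MissingLowerBoundAt
  rw [shaAn_variableChange_of_isGloballyMinimal W C, show (C • W).shaOrder = W.shaOrder from
    shaOrder_variableChange_holds W C]

/-- **`MissingUpperBoundAt` (`ord_p #Ш ≤ ord_p Ш_an`) is model-independent.** [cite: Miller2011LMS, Def. 1.1 (arXiv:1010.2431 p. 3)] -/
theorem missingUpperBoundAt_smul_iff : MissingUpperBoundAt (C • W) p ↔ MissingUpperBoundAt W p := by
  unfold MissingUpperBoundAt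
  rw [shaAn_variableChange_of_isGloballyMinimal W C, show (C • W).shaOrder = W.shaOrder from
    shaOrder_variableChange_holds W C]

/-- `MissingPPartAt` (`ord_p Ш_an = ord_p #Ш`) is model-independent. [cite: Miller2011LMS, Def. 1.1 (arXiv:1010.2431 p. 3)] -/
theorem missingPPartAt_smul_iff : MissingPPartAt (C • W) p ↔ MissingPPartAt W p := by
  unfold MissingPPartAt
  rw [shaAn_variableChange_of_isGloballyMinimal W C, show (C • W).shaOrder = W.shaOrder from
    shaOrder_variableChange_holds W C]

end Conclusions

/-! ### §3 The K1 / K2 / X3 instances transfer between globally minimal models -/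

section Instances

variable (W : WeierstrassCurve ℚ) [W.IsElliptic] [W.IsGloballyMinimal] (C : VariableChange ℚ)
  [(C • W).IsGloballyMinimal]

/-- **The K1 instance is model-independent**: the instance of `PSRankOneLowerHalfAtThree` at `C • W` holds
iff the instance at `W` does (all binders and the conclusion are invariants, §§1–2).
[cite: Miller2011LMS, Def. 1.1 (arXiv:1010.2431 p. 3)] [cite: SilvermanAEC2009, VII.1.3(b) and VIII.8.3] -/
theorem psLowerHalfInstance_smul_iff :
    (¬ (C • W).HasCM → ClassO6 (C • W) 3 → Surj (C • W) 3 →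
      Even (padicValInt 3 (C • W).minimalDiscriminantInt) →
      (C • W).minimalDiscriminantInt / 3 ^ padicValInt 3 (C • W).minimalDiscriminantInt % 3 = 1 →
      (C • W).analyticRank = 1 → MissingLowerBoundAt (C • W) 3) ↔
    (¬ W.HasCM → ClassO6 W 3 → Surj W 3 → Even (padicValInt 3 W.minimalDiscriminantInt) →
      W.minimalDiscriminantInt / 3 ^ padicValInt 3 W.minimalDiscriminantInt % 3 = 1 →
      W.analyticRank = 1 → MissingLowerBoundAt W 3) := by
  rw [hasCM_smul_iff W C, classO6_smul_iff W C 3, surj_smul_iff W C 3, minimalDiscriminantInt_smul W C,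
    analyticRank_smul W C, missingLowerBoundAt_smul_iff W C 3]

/-- **The K2 instance is model-independent.** [cite: Miller2011LMS, Def. 1.1 (arXiv:1010.2431 p. 3)]
[cite: SilvermanAEC2009, VII.1.3(b) and VIII.8.3] -/
theorem psUpperHalfInstance_smul_iff :
    (¬ (C • W).HasCM → ClassO6 (C • W) 3 → Surj (C • W) 3 →
      Even (padicValInt 3 (C • W).minimalDiscriminantInt) →
      (C • W).minimalDiscriminantInt / 3 ^ padicValInt 3 (C • W).minimalDiscriminantInt % 3 = 1 →
      (C • W).analyticRank = 1 → MissingUpperBoundAt (C • W) 3) ↔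
    (¬ W.HasCM → ClassO6 W 3 → Surj W 3 → Even (padicValInt 3 W.minimalDiscriminantInt) →
      W.minimalDiscriminantInt / 3 ^ padicValInt 3 W.minimalDiscriminantInt % 3 = 1 →
      W.analyticRank = 1 → MissingUpperBoundAt W 3) := by
  rw [hasCM_smul_iff W C, classO6_smul_iff W C 3, surj_smul_iff W C 3, minimalDiscriminantInt_smul W C,
    analyticRank_smul W C, missingUpperBoundAt_smul_iff W C 3]

/-- **The X3 (supercuspidal residual) instance is model-independent** (conclusion `BSDp W 3`, tree
`bsdp_variableChange_iff_of_isGloballyMinimal`). [cite: Miller2011LMS, Def. 1.1 (arXiv:1010.2431 p. 3)]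
[cite: SilvermanAEC2009, VII.1.3(b) and VIII.8.3] -/
theorem scResidualInstance_smul_iff :
    (¬ (C • W).HasCM → ClassO6 (C • W) 3 → Surj (C • W) 3 →
      ¬ (Even (padicValInt 3 (C • W).minimalDiscriminantInt) ∧
        (C • W).minimalDiscriminantInt / 3 ^ padicValInt 3 (C • W).minimalDiscriminantInt % 3 = 1) →
      (C • W).analyticRank = 1 → BSDp (C • W) 3) ↔
    (¬ W.HasCM → ClassO6 W 3 → Surj W 3 →
      ¬ (Even (padicValInt 3 W.minimalDiscriminantInt) ∧
        W.minimalDiscriminantInt / 3 ^ padicValInt 3 W.minimalDiscriminantInt % 3 = 1) →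
      W.analyticRank = 1 → BSDp W 3) := by
  rw [hasCM_smul_iff W C, classO6_smul_iff W C 3, surj_smul_iff W C 3, minimalDiscriminantInt_smul W C,
    analyticRank_smul W C, bsdp_variableChange_iff_of_isGloballyMinimal W C 3]

end Instances

/-! ### §4 It suffices to prove the cruxes on representatives -/

section Representatives

/-- **K1 on representatives.** Let `𝒮` be any family of Weierstrass equations such that every globally
minimal elliptic `W/ℚ` is `C • W₀` for some elliptic globally minimal `W₀ ∈ 𝒮`. If the K1 instance holds at
every member of `𝒮`, then `PSRankOneLowerHalfAtThree` holds. (The choice of globally minimal model — GNine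
recipe model, reduced model, … — is free.) [cite: SilvermanAEC2009, VII.1.3(b) and VIII.8.3]
[cite: Miller2011LMS, Def. 1.1 (arXiv:1010.2431 p. 3)] -/
theorem psRankOneLowerHalfAtThree_of_representatives (𝒮 : Set (WeierstrassCurve ℚ))
    (hrep : ∀ (W : WeierstrassCurve ℚ) [W.IsElliptic] [W.IsGloballyMinimal],
      ∃ (W₀ : WeierstrassCurve ℚ) (C : VariableChange ℚ) (_ : W₀.IsElliptic) (_ : W₀.IsGloballyMinimal),
        W₀ ∈ 𝒮 ∧ C • W₀ = W)
    (h𝒮 : ∀ (W₀ : WeierstrassCurve ℚ) [W₀.IsElliptic] [W₀.IsGloballyMinimal], W₀ ∈ 𝒮 →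
      ¬ W₀.HasCM → ClassO6 W₀ 3 → Surj W₀ 3 → Even (padicValInt 3 W₀.minimalDiscriminantInt) →
      W₀.minimalDiscriminantInt / 3 ^ padicValInt 3 W₀.minimalDiscriminantInt % 3 = 1 →
      W₀.analyticRank = 1 → MissingLowerBoundAt W₀ 3) :
    PSRankOneLowerHalfAtThree := by
  intro W _ hW
  obtain ⟨W₀, C, _, _, hmem, rfl⟩ := hrep W
  exact (psLowerHalfInstance_smul_iff W₀ C).mpr (h𝒮 W₀ hmem)

/-- **K2 on representatives.** [cite: SilvermanAEC2009, VII.1.3(b) and VIII.8.3] [cite: Miller2011LMS, Def. 1.1 (arXiv:1010.2431 p. 3)] -/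
theorem psRankOneUpperHalfAtThree_of_representatives (𝒮 : Set (WeierstrassCurve ℚ))
    (hrep : ∀ (W : WeierstrassCurve ℚ) [W.IsElliptic] [W.IsGloballyMinimal],
      ∃ (W₀ : WeierstrassCurve ℚ) (C : VariableChange ℚ) (_ : W₀.IsElliptic) (_ : W₀.IsGloballyMinimal),
        W₀ ∈ 𝒮 ∧ C • W₀ = W)
    (h𝒮 : ∀ (W₀ : WeierstrassCurve ℚ) [W₀.IsElliptic] [W₀.IsGloballyMinimal], W₀ ∈ 𝒮 →
      ¬ W₀.HasCM → ClassO6 W₀ 3 → Surj W₀ 3 → Even (padicValInt 3 W₀.minimalDiscriminantInt) →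
      W₀.minimalDiscriminantInt / 3 ^ padicValInt 3 W₀.minimalDiscriminantInt % 3 = 1 →
      W₀.analyticRank = 1 → MissingUpperBoundAt W₀ 3) :
    PSRankOneUpperHalfAtThree := by
  intro W _ hW
  obtain ⟨W₀, C, _, _, hmem, rfl⟩ := hrep W
  exact (psUpperHalfInstance_smul_iff W₀ C).mpr (h𝒮 W₀ hmem)

/-- **X3 on representatives.** [cite: SilvermanAEC2009, VII.1.3(b) and VIII.8.3] [cite: Miller2011LMS, Def. 1.1 (arXiv:1010.2431 p. 3)] -/
theorem wildSurjRankOneSupercuspidalAtThree_of_representatives (𝒮 : Set (WeierstrassCurve ℚ))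
    (hrep : ∀ (W : WeierstrassCurve ℚ) [W.IsElliptic] [W.IsGloballyMinimal],
      ∃ (W₀ : WeierstrassCurve ℚ) (C : VariableChange ℚ) (_ : W₀.IsElliptic) (_ : W₀.IsGloballyMinimal),
        W₀ ∈ 𝒮 ∧ C • W₀ = W)
    (h𝒮 : ∀ (W₀ : WeierstrassCurve ℚ) [W₀.IsElliptic] [W₀.IsGloballyMinimal], W₀ ∈ 𝒮 →
      ¬ W₀.HasCM → ClassO6 W₀ 3 → Surj W₀ 3 →
      ¬ (Even (padicValInt 3 W₀.minimalDiscriminantInt) ∧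
        W₀.minimalDiscriminantInt / 3 ^ padicValInt 3 W₀.minimalDiscriminantInt % 3 = 1) →
      W₀.analyticRank = 1 → BSDp W₀ 3) :
    WildSurjRankOneSupercuspidalAtThree := by
  intro W _ hW
  obtain ⟨W₀, C, _, _, hmem, rfl⟩ := hrep W
  exact (scResidualInstance_smul_iff W₀ C).mpr (h𝒮 W₀ hmem)

end Representatives

end Summit.BirchSwinnertonDyer.BirchSwinnertonDyer.Theorems.PSRowModelInvariance

end
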